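import Summits.AnomalousDissipation.AnomalousDissipation.Theorems.SolenoidalFractalHomogenisationLagrangianStepCellClauseCutsFamily
import Summits.AnomalousDissipation.AnomalousDissipation.Theorems.SolenoidalFractalHomogenisationLagrangianStepOneLevelSplitDefs
import Literature.Analysis.FluidPDE.PassiveVectorTensorDistorted
import Literature.Analysis.FluidPDE.PassiveVectorTensorPropagator
import Mathlib.Analysis.InnerProductSpace.Adjoint
import HarnessLib

/-!
# K1L_D (stmt-AnomalousDissipation-27980): the MODULATED slow-vector cell clause (V_mod) in LOSS CURRENCY — definitions
# (Summits-side defs file of route `SolenoidalFractalHomogenisation`; lead-k1l-onelevel-p1 g4; tenure RULING D26-10, line γ2 of record)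

Memo L9 (`Cruxes/…/Lines/onelevel-L9-Z7-design.md`) and L10 (`…/onelevel-L10-Vmod-currency.md`); typed draft `…/onelevel_Vmod_draft.lean`.
The distortion transfer Z7 of the bilinear window bound (BIL, §9z of `stub_cellInputs`) is re-cut (D26-10) through a REGISTRY-LEVEL modulated cell
clause, to be certified like (V) (`SlowVectorClauseF`).  This file only DEFINES the objects; it proves nothing and closes nothing (AD is not proved;
rung F-D1.A0).  The loss-currency algebra (composition across a frame reset, strong bound) is `…LagrangianStepLossCurrency` (p690895).

* `IsModulation θ Tw nC G` — a modulation datum on a window of cell-time length `Tw`: the inverse Jacobian `G = (DX)⁻¹` of the coarse window flow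
  read in the frame, `G(0) = 1`, `|G − 1| ≤ θ`, `det G = 1`, Piola (columns divergence free), smooth in `y` with `|∇G| ≤ θ·nC`, Lipschitz in `t`;
* `IsDistortedPropagator Tw 𝔸 b G U` — the two-parameter propagator spec (`Torus.IsPropagator`, Pazy / DiPerna–Lions) over the DISTORTED weak class
  `Torus.IsWeakTensorPassiveVectorDistortedOn` (constraint `∇·(G·) = 0`, conjugated tensor), constraints read through `G`;
* `lossFwd T x = ‖x‖² − ‖T x‖²`, `lossAdj T ζ = ‖ζ‖² − ‖T† ζ‖²` — the forward / adjoint LOSSES of a window map on `V2` (Hilbert adjoint);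
* `SlowVectorClauseModE W M hM c Φ lo hi Λ β σ C ν₀ K θ₁ ϱ₁` — **(V_modE)**: for every member of the (V)-family, every modulation datum and every
  pair (cell member `U`, coarse member `T`) of distorted propagators, `|⟪(U s t − T s t)x, ζ⟫| ≤ η √(lossFwd (T s t) x) √(lossAdj (T s t) ζ)` for ALL
  `x, ζ`, `η = C(C(ν^σ + (⌈K/ν⌉/n)^σ + θ^σ + (nC/n)^σ) + ((M·Wp/ν)/(t−s))^σ)` (v0 error functional, (V)'s `C, σ` pattern; the certificate may refine it).

References: Armstrong–Vicol, arXiv:2305.05048 §4.1 (the distortion-adapted equation, `s_{m−1}`, PDF p. 34); Pazy 1983 Ch. 5 §5.1 (evolution systems).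
-/

set_option linter.dupNamespace false  -- the summit-side namespace `Summit.AnomalousDissipation.AnomalousDissipation.…` repeats a component by design (D-0017)

noncomputable section

namespace Summit.AnomalousDissipation.AnomalousDissipation.Theorems.SolenoidalFractalHomogenisation.LagrangianStep.CellClauseMod

open Literature.Analysis Literature.Analysis.FluidPDE Literature.Analysis.FunctionSpaces
open MeasureTheory Set Filter UnitAddTorus
open scoped ENNReal NNReal InnerProductSpace

/-! ## §1 Modulation data -/

/-- **A modulation datum on a window of (cell-)time length `Tw`**: a matrix field `G(t,y)` (the inverse Jacobian `(DX)⁻¹` of the coarse window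
flow, read in the frame and in cell units) with `G(0) = 1` (frame reset at the window's left end), `θ`-close to the identity, unimodular with
divergence-free columns (Piola: `∇·(G v) = Σ G_{ci} ∂_c v_i`, so the distorted constraint is a first-order operator), smooth in `y` with gradient
`≤ θ·nC` (`nC` = the modulation wavenumber, `N_m` in the cell units of level `m+1`), Lipschitz in `t`, with time variation of
total mass `≤ θ` (the accumulated strain; tenure D26-11 (A1)). -/
structure IsModulation (θ Tw nC : ℝ) (G : ℝ → UnitAddTorus (Fin 3) → Matrix (Fin 3) (Fin 3) ℝ) : Prop where
  init : ∀ y, G 0 y = 1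
  near_one : ∀ t ∈ Icc 0 Tw, ∀ y i j, |G t y i j - (1 : Matrix (Fin 3) (Fin 3) ℝ) i j| ≤ θ
  det_one : ∀ t ∈ Icc 0 Tw, ∀ y, (G t y).det = 1
  piola : ∀ t ∈ Icc 0 Tw, ∀ i, Torus.IsDivFree (fun y => (WithLp.toLp 2 fun c => G t y c i : EuclideanSpace ℝ (Fin 3)))
  smooth : ∀ t ∈ Icc 0 Tw, ∀ i j, Torus.IsSmooth (fun y => G t y i j)
  grad_le : ∀ t ∈ Icc 0 Tw, ∀ y i j c, |Torus.partialDeriv c (fun y => G t y i j) y| ≤ θ * nC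
  lipschitz : ∃ L : ℝ≥0, ∀ y i j, LipschitzOnWith L (fun t => G t y i j) (Icc 0 Tw)
  /-- (A1, tenure D26-11) accumulated strain RATE: the time variation of `G` is dominated by an integrable rate of total mass `≤ θ`
  (`∫₀^{Tw} ‖∂_t G‖ ≤ θ`; the common Piola zero-order term `M = −J⁻¹∂_tJ` lives here). -/
  tvar : ∃ βr : ℝ → ℝ, (∀ t, 0 ≤ βr t) ∧ IntegrableOn βr (Icc 0 Tw) volume ∧ (∫ t in Icc 0 Tw, βr t) ≤ θ ∧
    ∀ y i j, ∀ t₁ ∈ Icc 0 Tw, ∀ t₂ ∈ Icc 0 Tw, t₁ ≤ t₂ → |G t₂ y i j - G t₁ y i j| ≤ ∫ t in Icc t₁ t₂, βr t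

/-! ## §2 Distorted propagators and the two losses -/

/-- **The propagator spec over the DISTORTED class** (`IsPropagator` with `IsWeakTensorPassiveVectorOn ↦ IsWeakTensorPassiveVectorDistortedOn`
and the divergence constraints read through `G`): contraction, cocycle, identity at `s = t` on `G(s)`-solenoidal data, `G(t)`-solenoidal range,
vanishing on the orthogonal complement of the `G(s)`-solenoidal classes, weak continuity, and representation of every distorted weak solution. -/
structure IsDistortedPropagator (Tw : ℝ) (𝔸 : Torus.Visc4 (Fin 3)) (b : ℝ → VF)
    (G : ℝ → UnitAddTorus (Fin 3) → Matrix (Fin 3) (Fin 3) ℝ) (U : ℝ → ℝ → (V2 →L[ℝ] V2)) : Prop where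
  norm_le : ∀ (s t : ℝ) (y : V2), ‖U s t y‖ ≤ ‖y‖
  comp : ∀ (s t r : ℝ), 0 ≤ s → s ≤ t → t ≤ r → r ≤ Tw → ∀ y : V2, U t r (U s t y) = U s r y
  self_of_divFree : ∀ (s : ℝ), 0 ≤ s → s ≤ Tw → ∀ y : V2, Torus.IsWeaklyDivFree (Torus.distort (G s) (y : VF)) → U s s y = y
  divFree : ∀ (s t : ℝ) (y : V2), Torus.IsWeaklyDivFree (Torus.distort (G t) ((U s t y : V2) : VF))
  eq_zero_of_orth : ∀ (s t : ℝ) (y : V2),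
    (∀ z : V2, Torus.IsWeaklyDivFree (Torus.distort (G s) (z : VF)) → ⟪y, z⟫_ℝ = 0) → U s t y = 0
  continuousOn : ∀ (s : ℝ), 0 ≤ s → s ≤ Tw → ∀ y z : V2, ContinuousOn (fun t => ⟪U s t y, z⟫_ℝ) (Icc s Tw)
  repr : ∀ (s : ℝ), 0 ≤ s → s < Tw → ∀ (φ : VF) (hφ : MemLp φ 2 volume), Torus.IsWeaklyDivFree (Torus.distort (G s) φ) →
    ∀ w : ℝ → VF, Torus.IsWeakTensorPassiveVectorDistortedOn 0 (Tw - s) 𝔸 (fun τ => b (s + τ)) (fun τ => G (s + τ)) φ w →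
      ∀ᵐ τ ∂(volume.restrict (Ioo 0 (Tw - s))), ∃ hτ : MemLp (w τ) 2 volume, hτ.toLp (w τ) = U s (s + τ) (hφ.toLp φ)

/-- The FORWARD LOSS of a window map: `q_T(x) = ‖x‖² − ‖T x‖²` (for a contraction: the energy dissipated; `≥ 0`, a quadratic form). -/
def lossFwd (T : V2 →L[ℝ] V2) (x : V2) : ℝ := ‖x‖ ^ 2 - ‖T x‖ ^ 2

/-- The ADJOINT LOSS of a window map: `q*_T(ζ) = ‖ζ‖² − ‖T† ζ‖²`, `T†` the Hilbert adjoint on `V2` (the energy the ADJOINT problem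
dissipates from the test datum `ζ`; intrinsic — no Fourier weights, no frame). -/
def lossAdj (T : V2 →L[ℝ] V2) (ζ : V2) : ℝ := ‖ζ‖ ^ 2 - ‖ContinuousLinearMap.adjoint T ζ‖ ^ 2

/-! ## §3 The modulated clause in loss currency -/

/-- **(V_modE) — the MODULATED slow-vector clause, loss currency (v0).**  For every member `(ν, n, 𝔸)` of the (V)-family
(`SlowVectorClauseF`'s binders: quasi-static `ν < ν₀`, `OddSmall 𝔸 (νβ)`, `NearIso 𝔸 (ν lo/λ) (ν hi λ)` for some `λ ∈ [1, Λ]`, resolution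
`⌈K/ν⌉ ≤ n`), every distortion `θ ≤ θ₁`, modulation ratio `nC ≤ ϱ₁·n`, window `Tw > 0`, modulation datum `G`, and every pair of distorted
propagators — `U` of the CELL member (drift `cellField W M hM ν n`, tensor `(1/n²)𝔸`, distortion `G`) and `T` of the COARSE member (no drift,
tensor `(1/n²)(𝔸 + (c/ν)Φ_ν((1/ν)𝔸))`, distortion `G`) — and ALL data `x, ζ ∈ V2`, `0 ≤ s < t ≤ Tw`:
`|⟪(U s t − T s t) x, ζ⟫| ≤ η · √(q_{T s t}(x)) · √(q*_{T s t}(ζ))`,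
`η = C·(C·(ν^σ + (⌈K/ν⌉/n)^σ + θ^σ + (nC/n)^σ) + ((M·Wp/ν)/(t − s))^σ)`.
WHY THE COARSE MEMBER'S LOSSES (tenure D26-11 (A3)): both `lossFwd (T s t)` and `lossAdj (T s t)` are losses of `T`, never of `U` — the coarse member is
drift-free in the frame, so its losses are converted to the Fourier N-currency of §9z ONCE, by Dirichlet-form monotonicity (Z7β(iii)); the true
member's loss never appears (its N-currency control, `FlatWindow.flatEnergyTracking` p690284, is only needed flat).  For `G ≡ 1` the clause is the
flat loss-currency (BIL) (`SlowVectorClauseLossFlat`, bridge `slowVectorClauseLossFlat_of_modE`).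
[cite: ArmstrongVicol2025, §4.1 (PDF p. 34: the distortion-adapted comparison problem)] -/
def SlowVectorClauseModE {k : ℕ} (W : LatticeShear.LatticeWord k) (M : ℝ) (hM : 0 < M) (c : ℝ)
    (Φ : ℝ → Torus.Visc4 (Fin 3) → Torus.Visc4 (Fin 3)) (lo hi Λ β σ C ν₀ K θ₁ ϱ₁ : ℝ) : Prop :=
  ∀ ν, ∀ hν : ν ∈ Set.Ioo 0 ν₀, ∀ n : ℕ, (⌈K / ν⌉₊ : ℝ) ≤ n → ∀ 𝔸 : Torus.Visc4 (Fin 3),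
    Torus.OddSmall 𝔸 (ν * β) → (∃ lam ∈ Set.Icc (1:ℝ) Λ, Torus.NearIso 𝔸 (ν * (lo / lam)) (ν * (hi * lam))) →
    ∀ θ ∈ Set.Icc 0 θ₁, ∀ nC : ℝ, 0 ≤ nC → nC ≤ ϱ₁ * n → ∀ Tw > (0:ℝ),
    ∀ G : ℝ → UnitAddTorus (Fin 3) → Matrix (Fin 3) (Fin 3) ℝ, IsModulation θ Tw nC G →
    ∀ U T : ℝ → ℝ → (V2 →L[ℝ] V2),
      IsDistortedPropagator Tw ((1 / (n:ℝ) ^ 2) • 𝔸) (cellField W M hM ν hν.1 n) G U →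
      IsDistortedPropagator Tw ((1 / (n:ℝ) ^ 2) • (𝔸 + (c / ν) • Φ ν ((1 / ν) • 𝔸))) (fun _ _ => 0) G T →
    ∀ s t : ℝ, 0 ≤ s → s < t → t ≤ Tw → ∀ x ζ : V2,
      |⟪U s t x - T s t x, ζ⟫_ℝ|
        ≤ (C * (C * (ν ^ σ + ((⌈K / ν⌉₊ : ℝ) / n) ^ σ + θ ^ σ + (nC / n) ^ σ) + ((M * W.period / ν) / (t - s)) ^ σ))
          * Real.sqrt (lossFwd (T s t) x) * Real.sqrt (lossAdj (T s t) ζ)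


/-! ## §4 Consistency bridge (tenure D26-11 (A2)): at `G ≡ 1` the clause is the flat loss-currency (BIL) -/

/-- **The FLAT loss-currency clause** — `SlowVectorClauseModE` at `G ≡ 1`, stated over ordinary propagators (`Torus.IsPropagator`) of the cell
member and of the coarse member: for all `x, ζ`, `|⟪(U s t − T s t)x, ζ⟫| ≤ η₀ √(lossFwd (T s t) x) √(lossAdj (T s t) ζ)`,
`η₀ = C(C(ν^σ + (⌈K/ν⌉/n)^σ) + ((M·Wp/ν)/(t−s))^σ)`.  (Its slow×slow block is what (V) `SlowVectorClauseF` delivers modewise; a refuter can test the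
modulated clause against the certified flat one through `slowVectorClauseLossFlat_of_modE`.) -/
def SlowVectorClauseLossFlat {k : ℕ} (W : LatticeShear.LatticeWord k) (M : ℝ) (hM : 0 < M) (c : ℝ)
    (Φ : ℝ → Torus.Visc4 (Fin 3) → Torus.Visc4 (Fin 3)) (lo hi Λ β σ C ν₀ K : ℝ) : Prop :=
  ∀ ν, ∀ hν : ν ∈ Set.Ioo 0 ν₀, ∀ n : ℕ, (⌈K / ν⌉₊ : ℝ) ≤ n → ∀ 𝔸 : Torus.Visc4 (Fin 3),
    Torus.OddSmall 𝔸 (ν * β) → (∃ lam ∈ Set.Icc (1:ℝ) Λ, Torus.NearIso 𝔸 (ν * (lo / lam)) (ν * (hi * lam))) →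
    ∀ Tw > (0:ℝ), ∀ U T : ℝ → ℝ → (V2 →L[ℝ] V2),
      Torus.IsPropagator Tw (cellField W M hM ν hν.1 n) ((1 / (n:ℝ) ^ 2) • 𝔸) U →
      Torus.IsPropagator Tw (fun _ _ => 0) ((1 / (n:ℝ) ^ 2) • (𝔸 + (c / ν) • Φ ν ((1 / ν) • 𝔸))) T →
    ∀ s t : ℝ, 0 ≤ s → s < t → t ≤ Tw → ∀ x ζ : V2,
      |⟪U s t x - T s t x, ζ⟫_ℝ|
        ≤ (C * (C * (ν ^ σ + ((⌈K / ν⌉₊ : ℝ) / n) ^ σ) + ((M * W.period / ν) / (t - s)) ^ σ))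
          * Real.sqrt (lossFwd (T s t) x) * Real.sqrt (lossAdj (T s t) ζ)

/-- A constant has vanishing torus partial derivatives. -/
theorem partialDeriv_const_fun (c : Fin 3) (K : ℝ) (y : UnitAddTorus (Fin 3)) :
    Torus.partialDeriv c (fun _ : UnitAddTorus (Fin 3) => K) y = 0 := by
  unfold Torus.partialDeriv Torus.lineDeriv
  simp

/-- **The identity is a modulation datum** with `θ = 0`, any window and any `nC`. -/
theorem isModulation_one {Tw nC : ℝ} : IsModulation 0 Tw nC (fun _ _ => (1 : Matrix (Fin 3) (Fin 3) ℝ)) where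
  init := fun _ => rfl
  near_one := fun t _ y i j => by simp
  det_one := fun t _ y => Matrix.det_one
  piola := fun t _ i x => by
    unfold Torus.divergence
    exact Finset.sum_eq_zero fun c _ => partialDeriv_const_fun c _ x
  smooth := fun t _ i j => Torus.isSmooth_const _
  grad_le := fun t _ y i j c => by rw [partialDeriv_const_fun, abs_zero, zero_mul]
  lipschitz := ⟨0, fun y i j => (LipschitzWith.const' _).lipschitzOnWith⟩
  tvar := ⟨fun _ => 0, fun _ => le_rfl, integrableOn_zero, by simp, fun y i j t₁ _ t₂ _ _ => by simp⟩

/-- **An ordinary propagator is a distorted propagator for `G ≡ 1`** (`distort 1 = id`, and every `G ≡ 1`-distorted weak solution is a flat one,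
`IsWeakTensorPassiveVectorDistortedOn.of_one_toFlat`). -/
theorem isDistortedPropagator_one_of_isPropagator {Tw : ℝ} {𝔸 : Torus.Visc4 (Fin 3)} {b : ℝ → VF} {U : ℝ → ℝ → (V2 →L[ℝ] V2)}
    (hU : Torus.IsPropagator Tw b 𝔸 U) : IsDistortedPropagator Tw 𝔸 b (fun _ _ => (1 : Matrix (Fin 3) (Fin 3) ℝ)) U where
  norm_le := hU.norm_le
  comp := hU.comp
  self_of_divFree := fun s hs hsT y hy => hU.self_of_divFree s hs hsT y (by simpa using hy)
  divFree := fun s t y => by simpa using hU.divFree s t y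
  eq_zero_of_orth := fun s t y h => hU.eq_zero_of_orth s t y fun z hz => h z (by simpa using hz)
  continuousOn := hU.continuousOn
  repr := fun s hs hsT φ hφ hφdiv w hw =>
    hU.repr s hs hsT φ hφ (by simpa using hφdiv) w (Torus.IsWeakTensorPassiveVectorDistortedOn.of_one_toFlat hw)

/-- **Consistency bridge** (tenure D26-11 (A2)): the modulated clause implies the flat loss-currency clause (take `θ = 0`, `nC = 0`, `G ≡ 1`;
`0^σ = 0` for `σ > 0`). -/
theorem slowVectorClauseLossFlat_of_modE {k : ℕ} {W : LatticeShear.LatticeWord k} {M : ℝ} {hM : 0 < M} {c : ℝ}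
    {Φ : ℝ → Torus.Visc4 (Fin 3) → Torus.Visc4 (Fin 3)} {lo hi Λ β σ C ν₀ K θ₁ ϱ₁ : ℝ} (hσ : 0 < σ) (hθ₁ : 0 ≤ θ₁) (hϱ₁ : 0 ≤ ϱ₁)
    (h : SlowVectorClauseModE W M hM c Φ lo hi Λ β σ C ν₀ K θ₁ ϱ₁) : SlowVectorClauseLossFlat W M hM c Φ lo hi Λ β σ C ν₀ K := by
  intro ν hν n hn 𝔸 hodd hwin Tw hTw U T hU hT s t hs hst htT x ζ
  have key := h ν hν n hn 𝔸 hodd hwin 0 ⟨le_rfl, hθ₁⟩ 0 le_rfl (by positivity) Tw hTw (fun _ _ => 1) isModulation_one U T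
    (isDistortedPropagator_one_of_isPropagator hU) (isDistortedPropagator_one_of_isPropagator hT) s t hs hst htT x ζ
  have h0 : (0:ℝ) ^ σ = 0 := Real.zero_rpow hσ.ne'
  rw [zero_div, h0, add_zero, add_zero] at key
  exact key

/-! ## §5 (V_modE) v2 — the CAPPED transient (amendment 1; lead-k1l-onelevel-p1 g5; tenure RULINGS D26-13 / D26-13′, finding F-lead-g5-1)

The §9z window `[j·R, s′]` of `stub_cellInputs` spans the refresh boundary `(j+1)·R`; its second piece `[(j+1)R, s′]` has ARBITRARY length
`τ₂ ∈ (0, R]` (p5 g14, T3 memo v3 F2-reversal; D26-13′ (1): no window floor).  The glue composes the two pieces with `LossCurrency`'s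
`lossBound_comp_raw`, whose first term carries the piece-1 error into piece 2 with the factor `η₂(τ₂)·η₁`; since the adjoint loss of the short piece
has no `τ₂`-gain on saturated test data, `η₂` must be bounded UNIFORMLY in `τ₂` (finding F-lead-g5-1).  The certifier's block table (memo L11 §1:
generator limit `τ → 0⁺` bounded; axis-slot diagonal `(κ² − 1)/2 ≈ 10.6`; leak / memory `0.227(P/τ) + 0.064(P/τ)^{1/2}` for `τ ≥ P`) says exactly
that: the true transient is bounded by a design constant for all window lengths and decays like `(P/τ)^{1/2}` beyond a period.  v2 therefore CAPS
the transient term: `((M·Wp/ν)/(t−s))^σ ↦ (min 1 ((M·Wp/ν)/(t−s)))^σ` (the constant `C` — written `Cm ≥ C` in the glue's first hypothesis and in the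
future registry stub `stub_Vmod_of_V`, D26-13′ (2) — absorbs the cap, `Cm ≥ 10.6·…` at the design).  Everything else is v1 VERBATIM; v2 implies v1
(`slowVectorClauseModE_of_modEC`).  Definitions only; nothing about (V_mod), §9z, the crux or AD is proved here (rung F-D1.A0). -/

/-- **(V_modEC) — the MODULATED slow-vector clause in loss currency, v2 (CAPPED transient).**  Same binders and conclusion as
`SlowVectorClauseModE` (v1) except that the transient term of the error functional is capped at one period:
`η = C·(C·(ν^σ + (⌈K/ν⌉/n)^σ + θ^σ + (nC/n)^σ) + (min 1 ((M·Wp/ν)/(t − s)))^σ)`.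
NOTES FOR INSTANTIATION / CERTIFICATION (tenure D26-13, D26-13′; certifier memo L11):
* (Option C) the certifiable transient is `η_tr(τ) = c_mem·(P/τ) + c_leak·(P/τ)^{1/2}` for `τ ≥ P` (`c_mem ≈ 0.23`, `c_leak ≈ 0.064` at the D1/W₁
  design) and a bounded constant below a period (generator limit; axis-slot diagonal `(κ²−1)/2 ≈ 10.6`): the exponent `1/2` is SHARP for all-data
  clauses, so an instantiation with this `σ` is valid iff `σ ≤ 1/2` up to the constant (`min 1 x ^ σ ≥ min 1 x ^ (1/2)` for `σ ≤ 1/2`); the glue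
  `cellInputs_BIL_of` uses only `min σ (1/2)`.
* (F4) the admissible distortion range `θ ≤ θ₁` must satisfy the RELATIVE-ELLIPTICITY side condition `(2θ̂₁ + θ̂₁²)·hi·Λ²/lo < 1`, `θ̂₁ = 3θ₁`
  (the conjugated tensor stays coercive), and the dependence of `η` on `θ` is LINEAR in truth (`θ^σ`, `σ ≤ 1`, is an admissible envelope);
  modulation ratio `ϱ₁ < 1/2`.
* No window floor (D26-13′ (1)): sub-period windows ARE used by the glue (the post-refresh piece).
[cite: ArmstrongVicol2025, §4.1 (PDF p. 34: the distortion-adapted comparison problem)] -/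
def SlowVectorClauseModEC {k : ℕ} (W : LatticeShear.LatticeWord k) (M : ℝ) (hM : 0 < M) (c : ℝ)
    (Φ : ℝ → Torus.Visc4 (Fin 3) → Torus.Visc4 (Fin 3)) (lo hi Λ β σ C ν₀ K θ₁ ϱ₁ : ℝ) : Prop :=
  ∀ ν, ∀ hν : ν ∈ Set.Ioo 0 ν₀, ∀ n : ℕ, (⌈K / ν⌉₊ : ℝ) ≤ n → ∀ 𝔸 : Torus.Visc4 (Fin 3),
    Torus.OddSmall 𝔸 (ν * β) → (∃ lam ∈ Set.Icc (1:ℝ) Λ, Torus.NearIso 𝔸 (ν * (lo / lam)) (ν * (hi * lam))) →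
    ∀ θ ∈ Set.Icc 0 θ₁, ∀ nC : ℝ, 0 ≤ nC → nC ≤ ϱ₁ * n → ∀ Tw > (0:ℝ),
    ∀ G : ℝ → UnitAddTorus (Fin 3) → Matrix (Fin 3) (Fin 3) ℝ, IsModulation θ Tw nC G →
    ∀ U T : ℝ → ℝ → (V2 →L[ℝ] V2),
      IsDistortedPropagator Tw ((1 / (n:ℝ) ^ 2) • 𝔸) (cellField W M hM ν hν.1 n) G U →
      IsDistortedPropagator Tw ((1 / (n:ℝ) ^ 2) • (𝔸 + (c / ν) • Φ ν ((1 / ν) • 𝔸))) (fun _ _ => 0) G T →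
    ∀ s t : ℝ, 0 ≤ s → s < t → t ≤ Tw → ∀ x ζ : V2,
      |⟪U s t x - T s t x, ζ⟫_ℝ|
        ≤ (C * (C * (ν ^ σ + ((⌈K / ν⌉₊ : ℝ) / n) ^ σ + θ ^ σ + (nC / n) ^ σ) + (min 1 ((M * W.period / ν) / (t - s))) ^ σ))
          * Real.sqrt (lossFwd (T s t) x) * Real.sqrt (lossAdj (T s t) ζ)

/-- **v2 ⇒ v1**: the capped clause implies `SlowVectorClauseModE` (`min 1 x ^ σ ≤ x ^ σ` for `x ≥ 0`, `σ > 0`; the two losses are nonnegative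
because `T s t` is a contraction). -/
theorem slowVectorClauseModE_of_modEC {k : ℕ} {W : LatticeShear.LatticeWord k} {M : ℝ} {hM : 0 < M} {c : ℝ}
    {Φ : ℝ → Torus.Visc4 (Fin 3) → Torus.Visc4 (Fin 3)} {lo hi Λ β σ C ν₀ K θ₁ ϱ₁ : ℝ} (hσ : 0 < σ) (hC : 0 ≤ C)
    (h : SlowVectorClauseModEC W M hM c Φ lo hi Λ β σ C ν₀ K θ₁ ϱ₁) : SlowVectorClauseModE W M hM c Φ lo hi Λ β σ C ν₀ K θ₁ ϱ₁ := by
  intro ν hν n hn 𝔸 hodd hwin θ hθ nC hnC0 hnC Tw hTw G hG U T hU hT s t hs hst htT x ζ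
  have key := h ν hν n hn 𝔸 hodd hwin θ hθ nC hnC0 hnC Tw hTw G hG U T hU hT s t hs hst htT x ζ
  refine key.trans ?_
  have hX : 0 ≤ (M * W.period / ν) / (t - s) :=
    div_nonneg (div_nonneg (mul_nonneg hM.le
      (Summit.AnomalousDissipation.AnomalousDissipation.Theorems.SolenoidalFractalHomogenisation.PermissibleCarrier.period_pos W).le) hν.1.le)
      (by linarith)
  have hmin : (min 1 ((M * W.period / ν) / (t - s))) ^ σ ≤ ((M * W.period / ν) / (t - s)) ^ σ :=
    Real.rpow_le_rpow (le_min zero_le_one hX) (min_le_right _ _) hσ.le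
  have hS1 : 0 ≤ Real.sqrt (lossFwd (T s t) x) := Real.sqrt_nonneg _
  have hS2 : 0 ≤ Real.sqrt (lossAdj (T s t) ζ) := Real.sqrt_nonneg _
  have hin : 0 ≤ C * (ν ^ σ + ((⌈K / ν⌉₊ : ℝ) / n) ^ σ + θ ^ σ + (nC / n) ^ σ) := by
    have h1 : 0 ≤ ν ^ σ := Real.rpow_nonneg hν.1.le σ
    have h2 : 0 ≤ ((⌈K / ν⌉₊ : ℝ) / n) ^ σ := Real.rpow_nonneg (by positivity) σ
    have h3 : 0 ≤ θ ^ σ := Real.rpow_nonneg hθ.1 σ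
    have h4 : 0 ≤ (nC / n) ^ σ := Real.rpow_nonneg (div_nonneg hnC0 (Nat.cast_nonneg n)) σ
    exact mul_nonneg hC (by linarith)
  gcongr

end Summit.AnomalousDissipation.AnomalousDissipation.Theorems.SolenoidalFractalHomogenisation.LagrangianStep.CellClauseMod

end
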